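import Summits.QuantumFields.YangMills.Theses.InfraredLiouville

/-!
# Birth skeleton (BC3) for crux `IRLiouville` (stmt-QuantumFields-9705) — `Lines/birth.lean`

Registrar: `planner-skel-stmt-QuantumFields-9705-0` (skeleton-register one-shot; route
`route-QuantumFields-InfraredLiouville`, re-audit bin REPAIRABLE), 2026-08-17.
**SHAPE CERTIFICATE — read § Status before seating anyone on a stub.**

Crux (route file `Theses/InfraredLiouville.lean`, decl
`Summit.QuantumFields.YangMills.Theses.InfraredLiouville.IRLiouville`, rank 2, open-problem):
for every compact simple `G` and every faithful unitary lattice representation `r` there is `β₀`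
such that for `β ≥ β₀` every INFRARED scaling limit of Wilson's lattice theory at FIXED coupling `β`
— a constant-coupling `SpeciesScheme` (`sch.β ≡ β`, `|c_s(k)| ≤ K a_k^{-p}`, exact centring
`m_s(k) = ⟨s⟩_{torus}`) together with a `LabelledSchwingerFamily S` to which ALL joint rescaled
lattice functions converge on off-diagonal tensors — is the vacuum: `S n σ F = 0` for `n ≥ 1`.

## The seam: physics input at weak coupling / analytic transfer to the blow-up

Any proof of the typed text must (i) say something about Wilson's simple-`G` lattice theory at
large fixed `β` uniformly on large tori, and (ii) transport it through the infrared blow-up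
`x ↦ x / a_k`, the polynomial renormalisations and the flatness of `⁰𝒮`-tensors at the diagonal.
This skeleton cuts exactly there, in the WEAKEST lattice currency for which (ii) is a theorem:

* `stub_weakCouplingCentredDecay` — **(P) the physics, OPEN.** For compact simple `G`, any `r`:
  `∃ β₀ ∀ β ≥ β₀`, for every `n ≥ 1`, every string `σ` of local gauge-invariant observables and every
  order `p` there is `C` such that on EVERY torus of side `L + 1`, for positions `z_i` inside the
  quarter-period box (`4‖z_i‖_∞ < L + 1`, so torus separations are lattice separations), the
  expectation of the product of the CENTRED shifted observables `∏ᵢ (σᵢ ∘ τ_{z_i} − ⟨σᵢ⟩)` is at most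
  `C R^{-p}` in the minimal pairwise sup-separation `R` — super-polynomial decay of centred products,
  volume-uniform ("IR-trivial clustering in cluster-property form"). For `n = 1` it says the centred
  one-point function vanishes identically (true: torus translation invariance,
  `wilsonExpectation_comp_torusConfigShift`); for `n = 2` it is the volume-uniform, all-directions
  form of (and implies) the super-polynomial two-point decay that is the HYPOTHESIS of the sibling
  crux `ThinEdgeExclusion`;
  it is implied by (and strictly weaker than) the expected exponential lattice mass gap in its
  `n`-point cluster-expansion form (the large-`β` analogue of Osterwalder–Seiler 1978 Thm 3.5,
  tree `osterwalder_seiler_torusClustering_uniform`, proved at STRONG coupling only).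
  Why it might fail: it contains "4D simple-`G` Wilson theory has no power-law channel in ANY
  gauge-invariant local observable at any `β ≥ β₀`" ⊇ no Coulomb / conformal infrared phase of
  `SU(2)₄` (open since 1974; Chatterjee 2019 Problem 5.1); FALSE for `U(1)` (free-photon phase,
  Guth 1980 / Fröhlich–Spencer 1982; barrier `AbelianMasslessPhaseD4`) — hence `IsCompactSimpleLieGroup`.
* `stub_centredDecayForcesVacuum` — **(T) the transfer, TRUE / L-sized.** For every compact `G`,
  `r`, `β`: (P)'s decay property AT `β` forces every typed infrared limit `(sch, S)` at `β` to be the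
  vacuum for all `n ≥ 1`. Mechanism (the `n`-factor generalisation of the landed two-point engine
  `Theorems/InfraredLiouvilleStrongCouplingIRTrivial.lean`, `tendsto_latticeSchwinger_two` +
  `Cutoff` density): the step-`k` lattice `n`-point function is
  `(∏ c_{σᵢ}(k)) a_k^{4n} ∑_{x ∈ box^n} ∏ fᵢ(a_k xᵢ) ⟨∏ (σᵢ∘τ − m_{σᵢ})⟩`; exact centring makes the
  expectation (P)'s centred product; flatness of the off-diagonal tensor in ANY pair of arguments
  (`IsOffDiagonal.norm_le_seminorm_mul_pow_sub`, general `n`) gives `|∏ fᵢ(a xᵢ)| ≤ Φ_M (a R(x))^{M+1}`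
  in the minimal separation `R(x)`; (P) with `p = M + 1` turns `(aR)^{M+1}·|⟨…⟩|` into `C a^{M+1}`;
  `#box^n · a^{4n} = O(1)` for compactly supported factors and `∏|c| ≤ K a^{-P}`; total
  `O(a_k^{M+1-P}) → 0` with `M = P`; general tensors by the cut-off density and continuity of `S n σ`.
  Why it might fail: only Lean-size risk (integrability of `n`-fold products of bounded cylinder
  functions on the torus, the `n`-fold lattice sum, the guard `4⌊R₀/a_k⌋ < 2L_k + 1` eventually).
* `IRLiouville_of` — the composition, pure logic: `β₀` from (P), then (T) at each `β ≥ β₀`.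
  `IRLiouville_skeleton` kernel-checks that the two stubs instantiate its hypotheses.

## Status (honest): this certifies SHAPE; as a LINE it is the classical direction, not the thesis

The route's thesis uses `IRLiouville` as RIGIDITY (Kenig–Merle shape: compactness `IRCompactness`
+ rigidity ⇒ the gap, via `ThinEdgeExclusion`); its own foreseen split
(`LimitCompletion → RepellerLemma → NoAbelianOrInteractingLimit`, route header TWO-LAYER PLAN) is
not typable today: `RepellerLemma` (stmt-QuantumFields-9757, informal) waits on definition request
D1 `EffectiveActionChart`, and `LimitCompletion` is a selection statement (a dilation-covariant
non-vacuum limit from a non-vacuum one) over uncountably many species strings with no typed notion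
of "complete limit" in the tree. The registered seam is the converse, CLASSICAL direction
"massiveness ⇒ ultralocality of fixed-coupling scaling limits" (Aizenman–Duminil-Copin 2021 §1.2
fn 1; barrier `Literature.Barriers.QuantumFields.FixedCouplingUltralocality`, whose proved
two-point estimate is the `n = 2` shadow of (T)). Consequently (P) is STRONGER in physics content
than what the route extracts from the crux: the skeleton BRACKETS the crux —
`[(P): n-point volume-uniform super-polynomial centred decay, β ≥ β₀]  ⇒  IRLiouville
 ⇒ (with IRCompactness, as in `closes`)  [2-point super-polynomial decay, infinite-volume form
 = hypothesis of ThinEdgeExclusion]` — which is exactly the information a re-audit needs: the crux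
is not shredded (two genuine pieces, one open and one provable now), not a costume (neither piece is
the crux or the summit: (P) speaks of finite tori only, (T) is conditional on (P) at the given `β`),
and its open content is located, in classical terms, at "no power-law channel for simple `G`".
A lead choosing a LINE should prefer a rigidity line once D1 lands; (T) is worth landing anyway
(it serves every gap-first route: `ModularSelfDualFold.WeakCouplingLatticeGap`-type inputs in
`n`-point form then give `IRLiouville` for free).

## Disproof used

`Cruxes/IRLiouville/` had NO workfiles at registration (no `Disproof.lean`, no `_false_without_`
theorem, no landed `Theorems/IRLiouville/Negative/*`); `ledger negatives --problem QuantumFields`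
(5 entries, QCD ×4, MirrorModularBoosts ×1) contains nothing of the shape of (P) or (T). Tokens
honoured by construction: `IsCompactSimpleLieGroup` is load-bearing in (P) (U(1) photon phase
refutes (P) without it); exact centring and polynomial `c` are load-bearing in (T) (with `m ≠ ⟨s⟩`
the one-point function diverges like `c a^4 #box`; with super-polynomial `c` flatness cannot win).

## Audit

`lean check --json` (farm, 2026-08-17): rc 0; sorries = 2 = stubs (`stub_weakCouplingCentredDecay`,
`stub_centredDecayForcesVacuum`), zero elsewhere; `IRLiouville_of` axioms
`[propext, Classical.choice, Quot.sound]` (no `sorryAx`); audit: `IRLiouville_skeleton` "proves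
…InfraredLiouville.IRLiouville (route_item route-QuantumFields-InfraredLiouville); NOT closed:
axioms [sorryAx]" — i.e. the crux BY NAME modulo exactly the stubs. BC3 probes (registrar folder
`bc/IRLiouville_probe.lean`, same import, stub statements copied verbatim as `def StubP`, `def StubT`,
`set_option maxHeartbeats 400000` each): for X ∈ {StubP, StubT} and target ∈ {`IRLiouville`,
`_root_.YangMills`}, one `example : X → target` per tactic `exact?` · `intro h; simpa using h` ·
`intro h; simpa [StubP, StubT, IRLiouville, YangMills] using h` · `unfold X; intro h; simpa using h`
· `aesop` — 20/20 FAIL (`exact?`: "could not close the goal" ×4; `simpa`: type mismatch ×8;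
unfolding `simpa` on StubT: heartbeat cap reached ×4; `aesop`: "failed to prove the goal after
exhaustive search" ×4); control `StubP ∧ StubT → StubT` by `exact?` succeeds. Table in
`Lines/birth.md`. Namespace `Summit.QuantumFields.YangMills.Cruxes.IRLiouville.Birth`.
-/

set_option autoImplicit false

noncomputable section

namespace Summit.QuantumFields.YangMills.Cruxes.IRLiouville.Birth

open scoped BigOperators Topology
open Filter MeasureTheory
open Literature.MathematicalPhysics.QuantumFieldTheory Literature.MathematicalPhysics.QuantumLattice
  Literature.MathematicalPhysics.AQFT
open Literature.Probability.LatticeModels (Site)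
open Summit.QuantumFields.YangMills.Theses.InfraredLiouville (IRLiouville)

/-! ## § Stubs — the ONLY two `sorry`s of the file -/

/-- **Stub (P) `stub_weakCouplingCentredDecay` — IR-trivial clustering of Wilson's simple-`G`
lattice theory at weak coupling, cluster-property form (OPEN).** For compact simple `G` and any
faithful unitary lattice representation `r` there is `β₀` such that for every `β ≥ β₀`, every
`n ≥ 1`, every string `σ : Fin n → YMSpecies G` and every order `p` there is `C` with: on every
torus of side `L + 1`, for positions `z : Fin n → ℤ⁴` in the quarter-period box
(`4‖z i‖_∞ < L + 1`) and every `R ≥ 0` not exceeding any pairwise sup-separation `‖z i − z j‖_∞`,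
`R^p · |⟨∏ᵢ ((σ i) ∘ τ_{z i} − ⟨σ i⟩)⟩_{L+1, β}| ≤ C` (torus Wilson expectation in the
representation `r.ρ`; centring by the torus mean of the unshifted observable, as the scheme's exact
centring does). `n = 1`: the centred one-point function vanishes (translation invariance);
`n = 2`: volume-uniform super-polynomial two-point decay. Size: open-problem (⊇ no power-law
channel at weak coupling for simple `G`; false for `U(1)`). -/
theorem stub_weakCouplingCentredDecay :
    ∀ (G : Type) [Group G] [TopologicalSpace G] [IsTopologicalGroup G] [CompactSpace G]
      [MeasurableSpace G] [BorelSpace G], IsCompactSimpleLieGroup G → ∀ r : LatticeRep G,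
      ∃ β₀ : ℝ, ∀ β : ℝ, β₀ ≤ β →
        ∀ n : ℕ, n ≠ 0 → ∀ (σ : Fin n → YMSpecies G) (p : ℕ), ∃ C : ℝ,
          ∀ (L : ℕ) (z : Fin n → Site 4), (∀ i, 4 * ‖z i‖ < (L : ℝ) + 1) →
            ∀ R : ℝ, 0 ≤ R → (∀ i j, i ≠ j → R ≤ ‖z i - z j‖) →
              R ^ p *
                |wilsonExpectation (L := L + 1) r.ρ β (toTorusObservable (L + 1) fun U =>
                    ∏ i, ((σ i).F (configShift (z i) U) -
                      wilsonExpectation (L := L + 1) r.ρ β (toTorusObservable (L + 1) (σ i).F)))| ≤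
                C := by
  sorry

/-- **Stub (T) `stub_centredDecayForcesVacuum` — centred super-polynomial decay at `β` forces
every infrared limit at `β` to be the vacuum (TRUE, L-sized; all compact `G`).** For compact `G`,
`r`, `β`: IF the centred products of shifted local gauge-invariant observables decay
super-polynomially in the minimal separation, uniformly on tori (the body of (P) at this `β`),
THEN for every constant-coupling scheme `sch` (`sch.β ≡ β`, polynomially bounded `c`, exact
centring) and every labelled family `S` to which ALL joint rescaled lattice functions converge on
off-diagonal tensors, `S n σ F = 0` for all `n ≥ 1`, all `σ` and all off-diagonal real tensors
`F = ⊗ fᵢ` — the `n`-factor generalisation of the landed two-point engine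
`StrongCouplingIRTrivial.tendsto_latticeSchwinger_two` (flatness `(a R)^{M+1}` of `F` in the
closest pair × decay `R^{-(M+1)}` ⇒ `O(a_k^{M+1-Σpᵢ}) → 0` for compactly supported factors; cut-off
density `tendsto_cutoffTensor` and continuity of `S n σ` for general ones). -/
theorem stub_centredDecayForcesVacuum :
    ∀ (G : Type) [Group G] [TopologicalSpace G] [IsTopologicalGroup G] [CompactSpace G]
      [MeasurableSpace G] [BorelSpace G] (r : LatticeRep G) (β : ℝ),
      (∀ n : ℕ, n ≠ 0 → ∀ (σ : Fin n → YMSpecies G) (p : ℕ), ∃ C : ℝ,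
          ∀ (L : ℕ) (z : Fin n → Site 4), (∀ i, 4 * ‖z i‖ < (L : ℝ) + 1) →
            ∀ R : ℝ, 0 ≤ R → (∀ i j, i ≠ j → R ≤ ‖z i - z j‖) →
              R ^ p *
                |wilsonExpectation (L := L + 1) r.ρ β (toTorusObservable (L + 1) fun U =>
                    ∏ i, ((σ i).F (configShift (z i) U) -
                      wilsonExpectation (L := L + 1) r.ρ β (toTorusObservable (L + 1) (σ i).F)))| ≤
                C) →
      ∀ (sch : SpeciesScheme (YMSpecies G))
        (S : LabelledSchwingerFamily (YMSpecies G) (EuclideanSpace ℝ (Fin 4))),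
        (∀ k : ℕ, sch.β k = β) →
        (∀ s : YMSpecies G, ∃ (p : ℕ) (K : ℝ), ∀ k : ℕ, |sch.c s k| ≤ K * (sch.a k)⁻¹ ^ p) →
        (∀ (s : YMSpecies G) (k : ℕ), sch.m s k = ∫ U, s.F (torusLift (sch.side k) U)
          ∂(wilsonMeasure (d := 4) (L := sch.side k) r.ρ (sch.β k))) →
        (∀ n : ℕ, n ≠ 0 → ∀ (σ : Fin n → YMSpecies G)
          (f : Fin n → SchwartzMap (EuclideanSpace ℝ (Fin 4)) ℝ)
          (F : SchwartzMap (Fin n → EuclideanSpace ℝ (Fin 4)) ℂ),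
          IsTensorOf F (fun i => ofRealTest (f i)) → IsOffDiagonal F →
            Tendsto (fun k : ℕ => ((latticeSchwinger r.ρ sch (fun s => s.F) k n σ f : ℝ) : ℂ))
              atTop (𝓝 (S n σ F))) →
        ∀ n : ℕ, n ≠ 0 → ∀ (σ : Fin n → YMSpecies G)
          (f : Fin n → SchwartzMap (EuclideanSpace ℝ (Fin 4)) ℝ)
          (F : SchwartzMap (Fin n → EuclideanSpace ℝ (Fin 4)) ℂ),
          IsTensorOf F (fun i => ofRealTest (f i)) → IsOffDiagonal F → S n σ F = 0 := by
  sorry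

/-! ## § Assembly — sorry-free; concludes the route decl BY NAME -/

/-- **The two stub STATEMENTS give the crux BY NAME** (pure logic, no reference to the stubs
themselves, so any `sorry` here would be flagged — there is none): `β₀` from (P); at `β ≥ β₀` the
decay property holds and (T) kills every typed infrared limit. -/
theorem IRLiouville_of
    (hP : ∀ (G : Type) [Group G] [TopologicalSpace G] [IsTopologicalGroup G] [CompactSpace G]
      [MeasurableSpace G] [BorelSpace G], IsCompactSimpleLieGroup G → ∀ r : LatticeRep G,
      ∃ β₀ : ℝ, ∀ β : ℝ, β₀ ≤ β →
        ∀ n : ℕ, n ≠ 0 → ∀ (σ : Fin n → YMSpecies G) (p : ℕ), ∃ C : ℝ,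
          ∀ (L : ℕ) (z : Fin n → Site 4), (∀ i, 4 * ‖z i‖ < (L : ℝ) + 1) →
            ∀ R : ℝ, 0 ≤ R → (∀ i j, i ≠ j → R ≤ ‖z i - z j‖) →
              R ^ p *
                |wilsonExpectation (L := L + 1) r.ρ β (toTorusObservable (L + 1) fun U =>
                    ∏ i, ((σ i).F (configShift (z i) U) -
                      wilsonExpectation (L := L + 1) r.ρ β (toTorusObservable (L + 1) (σ i).F)))| ≤
                C)
    (hT : ∀ (G : Type) [Group G] [TopologicalSpace G] [IsTopologicalGroup G] [CompactSpace G]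
      [MeasurableSpace G] [BorelSpace G] (r : LatticeRep G) (β : ℝ),
      (∀ n : ℕ, n ≠ 0 → ∀ (σ : Fin n → YMSpecies G) (p : ℕ), ∃ C : ℝ,
          ∀ (L : ℕ) (z : Fin n → Site 4), (∀ i, 4 * ‖z i‖ < (L : ℝ) + 1) →
            ∀ R : ℝ, 0 ≤ R → (∀ i j, i ≠ j → R ≤ ‖z i - z j‖) →
              R ^ p *
                |wilsonExpectation (L := L + 1) r.ρ β (toTorusObservable (L + 1) fun U =>
                    ∏ i, ((σ i).F (configShift (z i) U) -
                      wilsonExpectation (L := L + 1) r.ρ β (toTorusObservable (L + 1) (σ i).F)))| ≤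
                C) →
      ∀ (sch : SpeciesScheme (YMSpecies G))
        (S : LabelledSchwingerFamily (YMSpecies G) (EuclideanSpace ℝ (Fin 4))),
        (∀ k : ℕ, sch.β k = β) →
        (∀ s : YMSpecies G, ∃ (p : ℕ) (K : ℝ), ∀ k : ℕ, |sch.c s k| ≤ K * (sch.a k)⁻¹ ^ p) →
        (∀ (s : YMSpecies G) (k : ℕ), sch.m s k = ∫ U, s.F (torusLift (sch.side k) U)
          ∂(wilsonMeasure (d := 4) (L := sch.side k) r.ρ (sch.β k))) →
        (∀ n : ℕ, n ≠ 0 → ∀ (σ : Fin n → YMSpecies G)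
          (f : Fin n → SchwartzMap (EuclideanSpace ℝ (Fin 4)) ℝ)
          (F : SchwartzMap (Fin n → EuclideanSpace ℝ (Fin 4)) ℂ),
          IsTensorOf F (fun i => ofRealTest (f i)) → IsOffDiagonal F →
            Tendsto (fun k : ℕ => ((latticeSchwinger r.ρ sch (fun s => s.F) k n σ f : ℝ) : ℂ))
              atTop (𝓝 (S n σ F))) →
        ∀ n : ℕ, n ≠ 0 → ∀ (σ : Fin n → YMSpecies G)
          (f : Fin n → SchwartzMap (EuclideanSpace ℝ (Fin 4)) ℝ)
          (F : SchwartzMap (Fin n → EuclideanSpace ℝ (Fin 4)) ℂ),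
          IsTensorOf F (fun i => ofRealTest (f i)) → IsOffDiagonal F → S n σ F = 0) :
    IRLiouville := by
  intro G _ _ _ _ _ _ hG r
  obtain ⟨β₀, hβ₀⟩ := hP G hG r
  exact ⟨β₀, fun β hβ sch S hβs hc hm hconv => hT G r β (hβ₀ β hβ) sch S hβs hc hm hconv⟩

/-- The birth skeleton: the crux modulo exactly the two registered stubs (P) and (T)
(kernel-checked signature match). -/
theorem IRLiouville_skeleton : IRLiouville :=
  IRLiouville_of stub_weakCouplingCentredDecay stub_centredDecayForcesVacuum

end Summit.QuantumFields.YangMills.Cruxes.IRLiouville.Birth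

end
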